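import Literature.NumberTheory.Rogawski1990.LocalTransferCentralSingularJunctionInvCM   -- ★ p841647 p08 (g13): the (R-inv) junction whose binder `hI′` this file pays (grammar of `Q′`, frame binders)
import Literature.NumberTheory.Rogawski1990.RankOneEulerPoincareNonsplitConsequences     -- ★ p841621∕p841705 (R2) + riders
import Literature.NumberTheory.Automorphic.OrbitalIntegralCompactFactorCanonical          -- ★ p841938∕ED. 2 FILE A: PAIR for canonical families
import Literature.NumberTheory.Automorphic.CompactGroupOrbitalIntegralCanonical           -- ★ p841205 (C-an): `IsCanonical.exists_isLocallyConstant_classOrbitalIntegral_eq`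
import Literature.NumberTheory.Automorphic.OrbitalMeasureCanonicalExistsCM                -- ★ canonical families on `U(J)(F_v)`, torus measures
import Literature.NumberTheory.Automorphic.StableCentralizerEquivCM                       -- ★ `localStableCentralizerEquiv`
import Literature.NumberTheory.Automorphic.UnitOrbitalIntegralFixedPointsPair             -- ★ `compactSpace_cmDatum_local_one_of_smul_eq`
import Literature.NumberTheory.Rogawski1990.LocalCentralizerTorusMeasureCM                -- ★ `isRegularElt_fst_snd_of_isLocalGRegular`
import Literature.NumberTheory.Rogawski1990.UnitFundamentalLemmaInertLeviClause           -- ★ `isLocalGRegular_conj_iff`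
import Literature.NumberTheory.Rogawski1990.UnitFundamentalLemmaExplicitNonsplitOfPlaces  -- ★ `smul_eq_of_subsingleton_placesOver`
import Literature.NumberTheory.Automorphic.LocalEndoscopicOrbitClosed                     -- ★ `isGRegular_of_isStablyConjH`
import HarnessLib

/-!
# THE COMPACT-SIDE JUNCTION — the `ε′`-side of `R_φ` near a central `(G,H)`-regular point is a LOCAL STABLE ORBITAL INTEGRAL on `H_v`, over the rank-one
# Euler–Poincaré letter (R2) BY NAME (Rogawski 1990 Prop. 8.2.1 (a)(d) ⟸ 8.1.3 at the second class; Langlands–Shelstad descent §2.4; Kottwitz 1988 §2)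

Topic `NumberTheory/Rogawski1990`; namespace `Literature.NumberTheory.Rogawski1990`.  THEOREMS ONLY (no definition, no instance, no notation, no named fact, no `sorry`).
Cell `pub/hodgecm-mathlib` (D-0151), crux H413 = stmt-HodgeConjecture-24833, floor-2 line «N6nsGerm» (`Cruxes/H413/Lines/F0_P3a_N6nsGerm.lean`, stub `stub_N6nsS1`);
LEAD F0P3a-plan (g9) WORD T8-88 (2) «`hI′` (B6) PAYER JUNCTION → B-p08 (g27)»; co-architects F0P2-p02 (g8) ∕ F0P3a-p08 (g13) «=» (census
`B-provers/B-p08/g27/CENSUS-B6-CompactSideJunction.B-p08g27.md`, (CNT) phrased on `H_v`-classes).  HONEST LABEL: HC_CM is proved only modulo the printed citations until rung 0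
closes; this file pays p08's binder `hI′` of ★ `exists_nhds_stableOrbitalIntegralRel_eq_of_central_singular_inv` ONLY MODULO its own binders — `hD′` (descent at the second class
`ε′` read on an abstract COMPACT dock `C′`, with compact-side saturation), `hΔ′` (constancy of `Δ‴_v` on the matched `Q′`-side classes), `hcnt` (the matched-class COUNT) — and the
named fact ★ `RankOneEulerPoincareNonsplit` (R2).

THE MATHEMATICS.  Near `ε_H`, for `γ_H` `G`-regular, a class `c` on the `Q′`-side is either unmatched (`Δ‴_v = 0`, ★ `finExplicitDelta_of_not_isLocalNormPair`) or matched; then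
`Δ‴_v(γ_H, c) = Δ₁` (`hΔ′`) and `Φ(c, ψ; m_G) = Φ^{C′}(⟦m⟧, ψ_{ε′}; m′)` for a pinned point `m` of any prescribed neighbourhood `B′` of the centre `ε_C` of the compact dock (`hD′`);
★ (C-an) makes `m ↦ Φ^{C′}(⟦m⟧, ψ_{ε′}; m′)` a LOCALLY CONSTANT `Ψ`, so with `B′ := {Ψ = Ψ(ε_C)}` the `Q′`-side sum is `Δ₁ Ψ(ε_C) · #{matched Q′-side classes}`.  By `hcnt` that
number is `#{H_v-classes stably conjugate to γ_H}` when `Z(γ_H.1)` is compact and the `Q′`-side is EMPTY otherwise.  On the `H`-side, (R2) gives `f ∈ C_c^∞(U(Φ₂)_v)` with canonical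
orbital integral `1` ∕ `0` at elliptic ∕ non-elliptic regular classes; for `ψ′ := Δ₁ Ψ(ε_C) · (f ∘ pr₁)` the PAIR lemmas of ★ FILE A (`U(Φ₁)_v` is compact at a non-split place, ★
`compactSpace_cmDatum_local_one_of_smul_eq`) give `Φ^H(d, ψ′) = Δ₁ Ψ(ε_C)` at every class `d` of the stable class of an elliptic `γ_H` (compactness of `Z(·.1)` is a stable-class
invariant, ★ `localStableCentralizerEquiv`) and `= 0` at the classes of a non-elliptic one, so `Φ^st_H(γ_H, ψ′)` equals the `Q′`-side sum in both cases.

* §1 plumbing on `H_v = U(Φ₂)_v × U(Φ₁)_v`: `compactSpace_centralizer_fst_iff_of_isLocalStablyConjH`, `isLocalGRegular_of_isLocalStablyConjH`, the push-forward Haar measure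
  `(pr₁)_* ν_H` on `U(Φ₂)_v` and a canonical family for it;
* §2 **`exists_nhds_finsum_side_eq_stableOrbitalIntegralRel_of_compact_dock`** — the junction: conclusion = p08's `hI′` binder VERBATIM (abstract `Q′`).

References: [Rogawski1990] §8.2 Prop. 8.2.1 (a)(d) p. 112, §8.1 Prop. 8.1.3 pp. 110–111, §4.3 (4.3.1) p. 43, §12.6 p. 174; [LanglandsShelstad1990Descent] Thm. 2.3.A, §2.4;
[Kottwitz1988] §2 Thm. 2; [Gelbart1975] p. 155 (10.19).
-/

set_option autoImplicit false

noncomputable section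

open Set Filter Topology MeasureTheory Measure
open scoped Matrix MatrixGroups ENNReal NNReal

namespace Literature.NumberTheory.Rogawski1990

open Literature.NumberTheory.Automorphic Literature.NumberTheory.Automorphic.UnitaryGroup Literature.NumberTheory.GaloisRepresentations
open Literature.MeasureTheory.Group
open _root_.NumberField _root_.IsDedekindDomain

section CompactSide

variable (L : Type) [Field L] [NumberField L] [IsCMField L] (H' : Matrix (Fin 3) (Fin 3) L) (v : HeightOneSpectrum (𝓞 ↥(maximalRealSubfield L)))

/-! ## §1 Plumbing on `H_v` -/

/-- `Φ₂` is hermitian for the CM conjugation. [cite: Rogawski1990, §1.9 p. 8] -/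
private theorem antidiagTwo_herm :
    ((Matrix.of fun i j : Fin 2 => if i.val + j.val + 1 = 2 then (1 : L) else 0).map (IsCMField.complexConj L))ᵀ =
      Matrix.of fun i j : Fin 2 => if i.val + j.val + 1 = 2 then (1 : L) else 0 :=
  antidiagOne_map_transpose (IsCMField.complexConj L) (N := 2)

omit [NumberField L] [IsCMField L] in
/-- `det Φ₂ ≠ 0`. [cite: Rogawski1990, §1.9 p. 8] -/
private theorem antidiagTwo_det_ne_zero : (Matrix.of fun i j : Fin 2 => if i.val + j.val + 1 = 2 then (1 : L) else 0).det ≠ 0 :=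
  (isUnit_antidiagOne_det (L := L) (N := 2)).ne_zero

/-- **Compactness of `Z(γ_H.1)` is a STABLE-CLASS invariant on `H_v`** at `G`-regular points: the centralisers of the first components of stably conjugate `G`-regular
`γ_H, δ_H` are isomorphic topological groups (★ `localStableCentralizerEquiv` on `U(Φ₂)_v`). [cite: Rogawski1990, §4.3 pp. 43–44; §3.1 p. 19] -/
theorem compactSpace_centralizer_fst_iff_of_isLocalStablyConjH
    {γH δH : (((cmDatum L 2 (Matrix.of fun i j : Fin 2 => if i.val + j.val + 1 = 2 then (1 : L) else 0)).Local v) ×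
      ((cmDatum L 1 (Matrix.of fun i j : Fin 1 => if i.val + j.val + 1 = 1 then (1 : L) else 0)).Local v))}
    (hγ : IsLocalGRegular L v γH) (hst : IsLocalStablyConjH L v γH δH) :
    CompactSpace (Subgroup.centralizer ({γH.1} : Set ((cmDatum L 2 (Matrix.of fun i j : Fin 2 => if i.val + j.val + 1 = 2 then (1 : L) else 0)).Local v))) ↔ CompactSpace (Subgroup.centralizer ({δH.1} : Set ((cmDatum L 2 (Matrix.of fun i j : Fin 2 => if i.val + j.val + 1 = 2 then (1 : L) else 0)).Local v))) := by
  have hreg := (isRegularElt_fst_snd_of_isLocalGRegular L v γH hγ).1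
  let e := localStableCentralizerEquiv L v (N := 2) (antidiagTwo_det_ne_zero L) (antidiagTwo_det_ne_zero L) hst.1 hreg
  constructor
  · intro h
    exact e.toHomeomorph.compactSpace
  · intro h
    exact e.symm.toHomeomorph.compactSpace

/-- `G`-regularity is a stable-class function on `H_v` (★ `isGRegular_of_isStablyConjH` on the CM carriers). [cite: Rogawski1990, §4.3 p. 42] -/
theorem isLocalGRegular_of_isLocalStablyConjH
    {γH δH : (((cmDatum L 2 (Matrix.of fun i j : Fin 2 => if i.val + j.val + 1 = 2 then (1 : L) else 0)).Local v) ×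
      ((cmDatum L 1 (Matrix.of fun i j : Fin 1 => if i.val + j.val + 1 = 1 then (1 : L) else 0)).Local v))}
    (hst : IsLocalStablyConjH L v γH δH) (hγ : IsLocalGRegular L v γH) : IsLocalGRegular L v δH :=
  isGRegular_of_isStablyConjH _ _ _ _ hst hγ

/-- Regularity of the `U(Φ₂)`-component passes to conjugates (★ `isRegularElt_conj_iff`). [cite: Rogawski1990, §3.1 p. 19] -/
theorem isRegularElt_fst_conj (x γ : ((cmDatum L 2 (Matrix.of fun i j : Fin 2 => if i.val + j.val + 1 = 2 then (1 : L) else 0)).Local v)) (hγ : IsRegularElt (γ.val : GL (Fin 2) (LocalRing L v))) :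
    IsRegularElt ((x * γ * x⁻¹ : ((cmDatum L 2 (Matrix.of fun i j : Fin 2 => if i.val + j.val + 1 = 2 then (1 : L) else 0)).Local v)).val : GL (Fin 2) (LocalRing L v)) :=
  isRegularElt_of_isConj (isConj_iff.2 ⟨x.val, rfl⟩) hγ

/-- **The push-forward `(pr₁)_* ν_H` of a Haar measure on `H_v` is a Haar measure on `U(Φ₂)_v`, right invariant if `ν_H` is** (`pr₁` is a continuous surjective PROPER
homomorphism, `U(Φ₁)_v` being compact at a non-split place). [cite: Rogawski1990, §4.9 p. 54] [cite: BourbakiGT1, Ch. III §2] -/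
theorem isHaarMeasure_map_fst_of_compactSpace
    [MeasurableSpace ((cmDatum L 2 (Matrix.of fun i j : Fin 2 => if i.val + j.val + 1 = 2 then (1 : L) else 0)).Local v)] [BorelSpace ((cmDatum L 2 (Matrix.of fun i j : Fin 2 => if i.val + j.val + 1 = 2 then (1 : L) else 0)).Local v)] [MeasurableSpace (((cmDatum L 2 (Matrix.of fun i j : Fin 2 => if i.val + j.val + 1 = 2 then (1 : L) else 0)).Local v) ×
      ((cmDatum L 1 (Matrix.of fun i j : Fin 1 => if i.val + j.val + 1 = 1 then (1 : L) else 0)).Local v))] [BorelSpace (((cmDatum L 2 (Matrix.of fun i j : Fin 2 => if i.val + j.val + 1 = 2 then (1 : L) else 0)).Local v) ×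
      ((cmDatum L 1 (Matrix.of fun i j : Fin 1 => if i.val + j.val + 1 = 1 then (1 : L) else 0)).Local v))]
    [CompactSpace ((cmDatum L 1 (Matrix.of fun i j : Fin 1 => if i.val + j.val + 1 = 1 then (1 : L) else 0)).Local v)]
    (νH : Measure (((cmDatum L 2 (Matrix.of fun i j : Fin 2 => if i.val + j.val + 1 = 2 then (1 : L) else 0)).Local v) ×
      ((cmDatum L 1 (Matrix.of fun i j : Fin 1 => if i.val + j.val + 1 = 1 then (1 : L) else 0)).Local v))) [νH.IsHaarMeasure] [νH.IsMulRightInvariant] :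
    (Measure.map (Prod.fst : (((cmDatum L 2 (Matrix.of fun i j : Fin 2 => if i.val + j.val + 1 = 2 then (1 : L) else 0)).Local v) ×
      ((cmDatum L 1 (Matrix.of fun i j : Fin 1 => if i.val + j.val + 1 = 1 then (1 : L) else 0)).Local v)) → ((cmDatum L 2 (Matrix.of fun i j : Fin 2 => if i.val + j.val + 1 = 2 then (1 : L) else 0)).Local v)) νH).IsHaarMeasure ∧
      (Measure.map (Prod.fst : (((cmDatum L 2 (Matrix.of fun i j : Fin 2 => if i.val + j.val + 1 = 2 then (1 : L) else 0)).Local v) ×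
      ((cmDatum L 1 (Matrix.of fun i j : Fin 1 => if i.val + j.val + 1 = 1 then (1 : L) else 0)).Local v)) → ((cmDatum L 2 (Matrix.of fun i j : Fin 2 => if i.val + j.val + 1 = 2 then (1 : L) else 0)).Local v)) νH).IsMulRightInvariant := by
  have hprop : Tendsto (Prod.fst : (((cmDatum L 2 (Matrix.of fun i j : Fin 2 => if i.val + j.val + 1 = 2 then (1 : L) else 0)).Local v) ×
      ((cmDatum L 1 (Matrix.of fun i j : Fin 1 => if i.val + j.val + 1 = 1 then (1 : L) else 0)).Local v)) → ((cmDatum L 2 (Matrix.of fun i j : Fin 2 => if i.val + j.val + 1 = 2 then (1 : L) else 0)).Local v)) (cocompact _) (cocompact _) := by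
    refine Filter.hasBasis_cocompact.tendsto_right_iff.2 fun K hK => ?_
    have hset : {x : (((cmDatum L 2 (Matrix.of fun i j : Fin 2 => if i.val + j.val + 1 = 2 then (1 : L) else 0)).Local v) ×
      ((cmDatum L 1 (Matrix.of fun i j : Fin 1 => if i.val + j.val + 1 = 1 then (1 : L) else 0)).Local v)) | x.1 ∈ Kᶜ} = (K ×ˢ (Set.univ : Set ((cmDatum L 1 (Matrix.of fun i j : Fin 1 => if i.val + j.val + 1 = 1 then (1 : L) else 0)).Local v)))ᶜ := by
      ext p; simp only [Set.mem_setOf_eq, Set.mem_compl_iff, Set.mem_prod, Set.mem_univ, and_true]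
    show {x : (((cmDatum L 2 (Matrix.of fun i j : Fin 2 => if i.val + j.val + 1 = 2 then (1 : L) else 0)).Local v) ×
      ((cmDatum L 1 (Matrix.of fun i j : Fin 1 => if i.val + j.val + 1 = 1 then (1 : L) else 0)).Local v)) | x.1 ∈ Kᶜ} ∈ cocompact _
    rw [hset]
    exact (hK.prod isCompact_univ).compl_mem_cocompact
  refine ⟨isHaarMeasure_map νH (MonoidHom.fst ((cmDatum L 2 (Matrix.of fun i j : Fin 2 => if i.val + j.val + 1 = 2 then (1 : L) else 0)).Local v) ((cmDatum L 1 (Matrix.of fun i j : Fin 1 => if i.val + j.val + 1 = 1 then (1 : L) else 0)).Local v)) continuous_fst Prod.fst_surjective hprop, ⟨fun g => ?_⟩⟩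
  rw [Measure.map_map (measurable_mul_const g) continuous_fst.measurable]
  have hcomp : ((fun x : ((cmDatum L 2 (Matrix.of fun i j : Fin 2 => if i.val + j.val + 1 = 2 then (1 : L) else 0)).Local v) => x * g) ∘ (Prod.fst : (((cmDatum L 2 (Matrix.of fun i j : Fin 2 => if i.val + j.val + 1 = 2 then (1 : L) else 0)).Local v) ×
      ((cmDatum L 1 (Matrix.of fun i j : Fin 1 => if i.val + j.val + 1 = 1 then (1 : L) else 0)).Local v)) → ((cmDatum L 2 (Matrix.of fun i j : Fin 2 => if i.val + j.val + 1 = 2 then (1 : L) else 0)).Local v))) = (Prod.fst : (((cmDatum L 2 (Matrix.of fun i j : Fin 2 => if i.val + j.val + 1 = 2 then (1 : L) else 0)).Local v) ×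
      ((cmDatum L 1 (Matrix.of fun i j : Fin 1 => if i.val + j.val + 1 = 1 then (1 : L) else 0)).Local v)) → ((cmDatum L 2 (Matrix.of fun i j : Fin 2 => if i.val + j.val + 1 = 2 then (1 : L) else 0)).Local v)) ∘ fun p : (((cmDatum L 2 (Matrix.of fun i j : Fin 2 => if i.val + j.val + 1 = 2 then (1 : L) else 0)).Local v) ×
      ((cmDatum L 1 (Matrix.of fun i j : Fin 1 => if i.val + j.val + 1 = 1 then (1 : L) else 0)).Local v)) => p * (g, 1) := by
    funext p; rfl
  rw [hcomp, ← Measure.map_map continuous_fst.measurable (measurable_mul_const _), map_mul_right_eq_self]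

/-- **A canonical family on `U(Φ₂)_v`** for the regular classes and any Haar measure (★ `OrbitalMeasureFamily.exists_isCanonical` fed by ★
`forall_isRegularElt_exists_isHaarMeasure_compactCore_centralizer_local_eq_one` at `J := Φ₂`), together with the torus-measure provider. [cite: Rogawski1990, §4.3 (4.3.1) p. 43] -/
theorem exists_isCanonical_cmDatum_local_two
    [MeasurableSpace ((cmDatum L 2 (Matrix.of fun i j : Fin 2 => if i.val + j.val + 1 = 2 then (1 : L) else 0)).Local v)] [BorelSpace ((cmDatum L 2 (Matrix.of fun i j : Fin 2 => if i.val + j.val + 1 = 2 then (1 : L) else 0)).Local v)]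
    [∀ γ : ((cmDatum L 2 (Matrix.of fun i j : Fin 2 => if i.val + j.val + 1 = 2 then (1 : L) else 0)).Local v), MeasurableSpace (((cmDatum L 2 (Matrix.of fun i j : Fin 2 => if i.val + j.val + 1 = 2 then (1 : L) else 0)).Local v) ⧸ Subgroup.centralizer ({γ} : Set ((cmDatum L 2 (Matrix.of fun i j : Fin 2 => if i.val + j.val + 1 = 2 then (1 : L) else 0)).Local v)))]
    [∀ γ : ((cmDatum L 2 (Matrix.of fun i j : Fin 2 => if i.val + j.val + 1 = 2 then (1 : L) else 0)).Local v), BorelSpace (((cmDatum L 2 (Matrix.of fun i j : Fin 2 => if i.val + j.val + 1 = 2 then (1 : L) else 0)).Local v) ⧸ Subgroup.centralizer ({γ} : Set ((cmDatum L 2 (Matrix.of fun i j : Fin 2 => if i.val + j.val + 1 = 2 then (1 : L) else 0)).Local v)))]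
    (ν₂ : Measure ((cmDatum L 2 (Matrix.of fun i j : Fin 2 => if i.val + j.val + 1 = 2 then (1 : L) else 0)).Local v)) [ν₂.IsHaarMeasure] [ν₂.IsMulRightInvariant] :
    (∀ γ : ((cmDatum L 2 (Matrix.of fun i j : Fin 2 => if i.val + j.val + 1 = 2 then (1 : L) else 0)).Local v), IsRegularElt (γ.val : GL (Fin 2) (LocalRing L v)) →
        ∃ t : Measure (Subgroup.centralizer ({γ} : Set ((cmDatum L 2 (Matrix.of fun i j : Fin 2 => if i.val + j.val + 1 = 2 then (1 : L) else 0)).Local v))), t.IsHaarMeasure ∧ t.IsInvInvariant ∧ t (compactCore (Subgroup.centralizer ({γ} : Set ((cmDatum L 2 (Matrix.of fun i j : Fin 2 => if i.val + j.val + 1 = 2 then (1 : L) else 0)).Local v)))) = 1) ∧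
      ∃ m₂ : OrbitalMeasureFamily ((cmDatum L 2 (Matrix.of fun i j : Fin 2 => if i.val + j.val + 1 = 2 then (1 : L) else 0)).Local v), m₂.IsCanonical (fun γ => IsRegularElt (γ.val : GL (Fin 2) (LocalRing L v))) ν₂ := by
  letI : MeasurableSpace («local» L (IsCMField.complexConj L) 2 (Matrix.of fun i j : Fin 2 => if i.val + j.val + 1 = 2 then (1 : L) else 0) v) :=
    ‹MeasurableSpace ((cmDatum L 2 (Matrix.of fun i j : Fin 2 => if i.val + j.val + 1 = 2 then (1 : L) else 0)).Local v)›
  haveI : BorelSpace («local» L (IsCMField.complexConj L) 2 (Matrix.of fun i j : Fin 2 => if i.val + j.val + 1 = 2 then (1 : L) else 0) v) :=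
    ‹BorelSpace ((cmDatum L 2 (Matrix.of fun i j : Fin 2 => if i.val + j.val + 1 = 2 then (1 : L) else 0)).Local v)›
  have ht := forall_isRegularElt_exists_isHaarMeasure_compactCore_centralizer_local_eq_one (IsCMField.complexConj L) 2
    (Matrix.of fun i j : Fin 2 => if i.val + j.val + 1 = 2 then (1 : L) else 0) (v := v) (IsCMField.complexConj_ne_one L) (antidiagTwo_herm L)
    (isUnit_antidiagOne_det (L := L) (N := 2))
  exact ⟨ht, OrbitalMeasureFamily.exists_isCanonical _ ν₂ ht⟩

/-! ## §2 The junction -/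

variable [iM' : ∀ γ : ((cmDatum L 3 H').Local v), MeasurableSpace (((cmDatum L 3 H').Local v) ⧸ Subgroup.centralizer ({γ} : Set ((cmDatum L 3 H').Local v)))]
  [iH : ∀ a : (((cmDatum L 2 (Matrix.of fun i j : Fin 2 => if i.val + j.val + 1 = 2 then (1 : L) else 0)).Local v) ×
      ((cmDatum L 1 (Matrix.of fun i j : Fin 1 => if i.val + j.val + 1 = 1 then (1 : L) else 0)).Local v)), MeasurableSpace ((((cmDatum L 2 (Matrix.of fun i j : Fin 2 => if i.val + j.val + 1 = 2 then (1 : L) else 0)).Local v) ×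
      ((cmDatum L 1 (Matrix.of fun i j : Fin 1 => if i.val + j.val + 1 = 1 then (1 : L) else 0)).Local v)) ⧸ Subgroup.centralizer ({a} : Set (((cmDatum L 2 (Matrix.of fun i j : Fin 2 => if i.val + j.val + 1 = 2 then (1 : L) else 0)).Local v) ×
      ((cmDatum L 1 (Matrix.of fun i j : Fin 1 => if i.val + j.val + 1 = 1 then (1 : L) else 0)).Local v))))]
  [bH : ∀ a : (((cmDatum L 2 (Matrix.of fun i j : Fin 2 => if i.val + j.val + 1 = 2 then (1 : L) else 0)).Local v) ×
      ((cmDatum L 1 (Matrix.of fun i j : Fin 1 => if i.val + j.val + 1 = 1 then (1 : L) else 0)).Local v)), BorelSpace ((((cmDatum L 2 (Matrix.of fun i j : Fin 2 => if i.val + j.val + 1 = 2 then (1 : L) else 0)).Local v) ×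
      ((cmDatum L 1 (Matrix.of fun i j : Fin 1 => if i.val + j.val + 1 = 1 then (1 : L) else 0)).Local v)) ⧸ Subgroup.centralizer ({a} : Set (((cmDatum L 2 (Matrix.of fun i j : Fin 2 => if i.val + j.val + 1 = 2 then (1 : L) else 0)).Local v) ×
      ((cmDatum L 1 (Matrix.of fun i j : Fin 1 => if i.val + j.val + 1 = 1 then (1 : L) else 0)).Local v))))]
  [MeasurableSpace (((cmDatum L 2 (Matrix.of fun i j : Fin 2 => if i.val + j.val + 1 = 2 then (1 : L) else 0)).Local v) ×
      ((cmDatum L 1 (Matrix.of fun i j : Fin 1 => if i.val + j.val + 1 = 1 then (1 : L) else 0)).Local v))] [BorelSpace (((cmDatum L 2 (Matrix.of fun i j : Fin 2 => if i.val + j.val + 1 = 2 then (1 : L) else 0)).Local v) ×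
      ((cmDatum L 1 (Matrix.of fun i j : Fin 1 => if i.val + j.val + 1 = 1 then (1 : L) else 0)).Local v))]

/-- **THE COMPACT-SIDE JUNCTION** — p08's binder `hI′` of ★ `exists_nhds_stableOrbitalIntegralRel_eq_of_central_singular_inv`, PAID modulo (D2ε′)+(sat′) `hD′`, (Δ-θ′) `hΔ′`,
the matched-class count `hcnt` and the named fact (R2) `hR2 : RankOneEulerPoincareNonsplit`.  Data: a non-split `v`; the explicit factor `Δ‴_v` (`μ hl hr`); `ν_H` Haar on `H_v` and
`m_H` CANONICAL for the `G`-regular classes; any family `m_G` on `G′_v`; a point `ε_H`; the `ε′`-side predicate `Q′` (abstract, as in ★ p841647); an abstract COMPACT group `C′`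
(the dock at the second class, e.g. `↥Z_{G′_v}(ε′)` itself) with Haar `ν′`, a family `m′` canonical for `P′`, and a base point `ε_C`.  CONCLUSION: for every `ψ ∈ C_c^∞(G′_v)` there
are `V₆ ∈ 𝓝 ε_H` and `ψ′ ∈ C_c^∞(H_v)` with `Σᶠ_{c : Q′-side} Δ‴_v(γ_H, out c)·Φ(c, ψ; m_G) = Φ^st_H(γ_H, ψ′; m_H)` for all `G`-regular `γ_H ∈ V₆`.
[cite: Rogawski1990, §8.2 Prop. 8.2.1 (a)(d) p. 112; §8.1 Prop. 8.1.3 pp. 110–111; §12.6 p. 174] [cite: LanglandsShelstad1990Descent, §2.4] [cite: Kottwitz1988, §2 Theorem 2] -/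
theorem exists_nhds_finsum_side_eq_stableOrbitalIntegralRel_of_compact_dock
    (hv : Subsingleton (UnitaryGroup.PlacesOver L v)) (μ : HeckeCharacter L)
    (hl : ∀ (v : HeightOneSpectrum (𝓞 ↥(maximalRealSubfield L))) (a : (((cmDatum L 2 (Matrix.of fun i j : Fin 2 => if i.val + j.val + 1 = 2 then (1 : L) else 0)).Local v) ×
      ((cmDatum L 1 (Matrix.of fun i j : Fin 1 => if i.val + j.val + 1 = 1 then (1 : L) else 0)).Local v))) (b : ((cmDatum L 3 H').Local v)) (x : (((cmDatum L 2 (Matrix.of fun i j : Fin 2 => if i.val + j.val + 1 = 2 then (1 : L) else 0)).Local v) ×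
      ((cmDatum L 1 (Matrix.of fun i j : Fin 1 => if i.val + j.val + 1 = 1 then (1 : L) else 0)).Local v))),
      finExplicitDelta L v H' (x * a * x⁻¹) μ b = finExplicitDelta L v H' a μ b)
    (hr : ∀ (v : HeightOneSpectrum (𝓞 ↥(maximalRealSubfield L))) (a : (((cmDatum L 2 (Matrix.of fun i j : Fin 2 => if i.val + j.val + 1 = 2 then (1 : L) else 0)).Local v) ×
      ((cmDatum L 1 (Matrix.of fun i j : Fin 1 => if i.val + j.val + 1 = 1 then (1 : L) else 0)).Local v))) (b y : ((cmDatum L 3 H').Local v)),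
      finExplicitDelta L v H' a μ (y * b * y⁻¹) = finExplicitDelta L v H' a μ b)
    (νH : Measure (((cmDatum L 2 (Matrix.of fun i j : Fin 2 => if i.val + j.val + 1 = 2 then (1 : L) else 0)).Local v) ×
      ((cmDatum L 1 (Matrix.of fun i j : Fin 1 => if i.val + j.val + 1 = 1 then (1 : L) else 0)).Local v))) [νH.IsHaarMeasure] [νH.IsMulRightInvariant]
    {mH : OrbitalMeasureFamily (((cmDatum L 2 (Matrix.of fun i j : Fin 2 => if i.val + j.val + 1 = 2 then (1 : L) else 0)).Local v) ×
      ((cmDatum L 1 (Matrix.of fun i j : Fin 1 => if i.val + j.val + 1 = 1 then (1 : L) else 0)).Local v))} {mG : OrbitalMeasureFamily ((cmDatum L 3 H').Local v)}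
    (hmH : mH.IsCanonical (IsLocalGRegular L v) νH)
    (εH : (((cmDatum L 2 (Matrix.of fun i j : Fin 2 => if i.val + j.val + 1 = 2 then (1 : L) else 0)).Local v) ×
      ((cmDatum L 1 (Matrix.of fun i j : Fin 1 => if i.val + j.val + 1 = 1 then (1 : L) else 0)).Local v)))
    (Q' : (((cmDatum L 2 (Matrix.of fun i j : Fin 2 => if i.val + j.val + 1 = 2 then (1 : L) else 0)).Local v) ×
      ((cmDatum L 1 (Matrix.of fun i j : Fin 1 => if i.val + j.val + 1 = 1 then (1 : L) else 0)).Local v)) → ((cmDatum L 3 H').Local v) → Prop)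
    -- the compact dock at the second class (abstract)
    (C' : Type) [Group C'] [TopologicalSpace C'] [IsTopologicalGroup C'] [CompactSpace C'] [LocallyCompactSpace C'] [SecondCountableTopology C'] [T2Space C']
    [MeasurableSpace C'] [BorelSpace C']
    [∀ m : C', MeasurableSpace (C' ⧸ Subgroup.centralizer ({m} : Set C'))] [∀ m : C', BorelSpace (C' ⧸ Subgroup.centralizer ({m} : Set C'))]
    (ν' : Measure C') [ν'.IsHaarMeasure] [ν'.IsMulRightInvariant] (P' : C' → Prop) {m' : OrbitalMeasureFamily C'} (hm' : m'.IsCanonical P' ν') (εC : C')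
    -- (D2ε′)+(sat′): DESCENT at the second class read on `C′`, with compact-side saturation
    (hD' : ∀ ψ : ((cmDatum L 3 H').Local v) → ℂ, IsLocSmooth ψ → ∃ ψε : C' → ℂ, IsLocallyConstant ψε ∧ ∀ B' ∈ 𝓝 εC, ∃ V ∈ 𝓝 εH, ∀ γH ∈ V, IsLocalGRegular L v γH →
        ∀ c : ConjClasses ((cmDatum L 3 H').Local v), (∃ x : ((cmDatum L 3 H').Local v), Q' γH (x * Quotient.out c * x⁻¹)) → IsLocalNormPair L H' v γH (Quotient.out c) →
          ∃ m ∈ B', P' (Quotient.out (ConjClasses.mk m)) ∧ classOrbitalIntegral mG ψ c = classOrbitalIntegral m' ψε (ConjClasses.mk m))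
    -- (Δ-θ′): `Δ‴_v` is constant on the matched `Q′`-side classes near `ε_H`
    (hΔ' : ∃ Δ₁ : ℂ, ∃ VΔ ∈ 𝓝 εH, ∀ γH ∈ VΔ, IsLocalGRegular L v γH → ∀ c : ConjClasses ((cmDatum L 3 H').Local v), (∃ x : ((cmDatum L 3 H').Local v), Q' γH (x * Quotient.out c * x⁻¹)) →
        IsLocalNormPair L H' v γH (Quotient.out c) → ((finExplicitCollection L H' μ hl hr) v).Δ γH (Quotient.out c) = Δ₁)
    -- (CNT): the matched `Q′`-side classes are as many as the stable class of `γ_H` in `H_v` if `Z(γ_H.1)` is compact, none otherwise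
    (hcnt : ∃ Vc ∈ 𝓝 εH, ∀ γH ∈ Vc, IsLocalGRegular L v γH →
        {c : ConjClasses ((cmDatum L 3 H').Local v) | (∃ x : ((cmDatum L 3 H').Local v), Q' γH (x * Quotient.out c * x⁻¹)) ∧ IsLocalNormPair L H' v γH (Quotient.out c)}.Finite ∧
        {d : ConjClasses (((cmDatum L 2 (Matrix.of fun i j : Fin 2 => if i.val + j.val + 1 = 2 then (1 : L) else 0)).Local v) ×
      ((cmDatum L 1 (Matrix.of fun i j : Fin 1 => if i.val + j.val + 1 = 1 then (1 : L) else 0)).Local v)) | IsLocalStablyConjH L v γH (Quotient.out d)}.Finite ∧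
        (CompactSpace (Subgroup.centralizer ({γH.1} : Set ((cmDatum L 2 (Matrix.of fun i j : Fin 2 => if i.val + j.val + 1 = 2 then (1 : L) else 0)).Local v))) →
          {c : ConjClasses ((cmDatum L 3 H').Local v) | (∃ x : ((cmDatum L 3 H').Local v), Q' γH (x * Quotient.out c * x⁻¹)) ∧ IsLocalNormPair L H' v γH (Quotient.out c)}.ncard =
            {d : ConjClasses (((cmDatum L 2 (Matrix.of fun i j : Fin 2 => if i.val + j.val + 1 = 2 then (1 : L) else 0)).Local v) ×
      ((cmDatum L 1 (Matrix.of fun i j : Fin 1 => if i.val + j.val + 1 = 1 then (1 : L) else 0)).Local v)) | IsLocalStablyConjH L v γH (Quotient.out d)}.ncard) ∧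
        (¬ CompactSpace (Subgroup.centralizer ({γH.1} : Set ((cmDatum L 2 (Matrix.of fun i j : Fin 2 => if i.val + j.val + 1 = 2 then (1 : L) else 0)).Local v))) →
          ∀ c : ConjClasses ((cmDatum L 3 H').Local v), (∃ x : ((cmDatum L 3 H').Local v), Q' γH (x * Quotient.out c * x⁻¹)) → ¬ IsLocalNormPair L H' v γH (Quotient.out c)))
    -- (R2) the named fact
    (hR2 : RankOneEulerPoincareNonsplit) :
    ∀ ψ : ((cmDatum L 3 H').Local v) → ℂ, IsLocSmooth ψ → ∃ V₆ ∈ 𝓝 εH, ∃ ψ' : (((cmDatum L 2 (Matrix.of fun i j : Fin 2 => if i.val + j.val + 1 = 2 then (1 : L) else 0)).Local v) ×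
      ((cmDatum L 1 (Matrix.of fun i j : Fin 1 => if i.val + j.val + 1 = 1 then (1 : L) else 0)).Local v)) → ℂ, IsLocSmooth ψ' ∧ ∀ γH ∈ V₆, IsLocalGRegular L v γH →
      (∑ᶠ c ∈ {c : ConjClasses ((cmDatum L 3 H').Local v) | ∃ x : ((cmDatum L 3 H').Local v), Q' γH (x * Quotient.out c * x⁻¹)},
          ((finExplicitCollection L H' μ hl hr) v).Δ γH (Quotient.out c) * classOrbitalIntegral mG ψ c) =
        stableOrbitalIntegralRel (IsLocalStablyConjH L v) mH ψ' γH := by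
  classical
  intro ψ hψ
  -- the Borel structure on `H_v` is the product of the Borel structures of the factors
  letI iU₂ : MeasurableSpace ((cmDatum L 2 (Matrix.of fun i j : Fin 2 => if i.val + j.val + 1 = 2 then (1 : L) else 0)).Local v) := borel _
  haveI : BorelSpace ((cmDatum L 2 (Matrix.of fun i j : Fin 2 => if i.val + j.val + 1 = 2 then (1 : L) else 0)).Local v) := ⟨rfl⟩
  letI iU₁ : MeasurableSpace ((cmDatum L 1 (Matrix.of fun i j : Fin 1 => if i.val + j.val + 1 = 1 then (1 : L) else 0)).Local v) := borel _
  haveI : BorelSpace ((cmDatum L 1 (Matrix.of fun i j : Fin 1 => if i.val + j.val + 1 = 1 then (1 : L) else 0)).Local v) := ⟨rfl⟩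
  have hHB : ‹MeasurableSpace (((cmDatum L 2 (Matrix.of fun i j : Fin 2 => if i.val + j.val + 1 = 2 then (1 : L) else 0)).Local v) ×
      ((cmDatum L 1 (Matrix.of fun i j : Fin 1 => if i.val + j.val + 1 = 1 then (1 : L) else 0)).Local v))› = Prod.instMeasurableSpace :=
    (@BorelSpace.measurable_eq (((cmDatum L 2 (Matrix.of fun i j : Fin 2 => if i.val + j.val + 1 = 2 then (1 : L) else 0)).Local v) ×
      ((cmDatum L 1 (Matrix.of fun i j : Fin 1 => if i.val + j.val + 1 = 1 then (1 : L) else 0)).Local v)) _ ‹MeasurableSpace (((cmDatum L 2 (Matrix.of fun i j : Fin 2 => if i.val + j.val + 1 = 2 then (1 : L) else 0)).Local v) ×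
      ((cmDatum L 1 (Matrix.of fun i j : Fin 1 => if i.val + j.val + 1 = 1 then (1 : L) else 0)).Local v))› ‹BorelSpace (((cmDatum L 2 (Matrix.of fun i j : Fin 2 => if i.val + j.val + 1 = 2 then (1 : L) else 0)).Local v) ×
      ((cmDatum L 1 (Matrix.of fun i j : Fin 1 => if i.val + j.val + 1 = 1 then (1 : L) else 0)).Local v))›).trans
      (@BorelSpace.measurable_eq (((cmDatum L 2 (Matrix.of fun i j : Fin 2 => if i.val + j.val + 1 = 2 then (1 : L) else 0)).Local v) ×
      ((cmDatum L 1 (Matrix.of fun i j : Fin 1 => if i.val + j.val + 1 = 1 then (1 : L) else 0)).Local v)) _ Prod.instMeasurableSpace Prod.borelSpace).symm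
  subst hHB
  letI : ∀ γ : ((cmDatum L 2 (Matrix.of fun i j : Fin 2 => if i.val + j.val + 1 = 2 then (1 : L) else 0)).Local v), MeasurableSpace (((cmDatum L 2 (Matrix.of fun i j : Fin 2 => if i.val + j.val + 1 = 2 then (1 : L) else 0)).Local v) ⧸ Subgroup.centralizer ({γ} : Set ((cmDatum L 2 (Matrix.of fun i j : Fin 2 => if i.val + j.val + 1 = 2 then (1 : L) else 0)).Local v))) := fun _ => borel _
  haveI : ∀ γ : ((cmDatum L 2 (Matrix.of fun i j : Fin 2 => if i.val + j.val + 1 = 2 then (1 : L) else 0)).Local v), BorelSpace (((cmDatum L 2 (Matrix.of fun i j : Fin 2 => if i.val + j.val + 1 = 2 then (1 : L) else 0)).Local v) ⧸ Subgroup.centralizer ({γ} : Set ((cmDatum L 2 (Matrix.of fun i j : Fin 2 => if i.val + j.val + 1 = 2 then (1 : L) else 0)).Local v))) := fun _ => ⟨rfl⟩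
  -- the place `w ∣ v` and compactness of `U(Φ₁)_v`
  obtain ⟨w⟩ : Nonempty (UnitaryGroup.PlacesOver L v) := inferInstance
  have hw : IsCMField.complexConj L • w.1 = w.1 := smul_eq_of_subsingleton_placesOver L hv w
  haveI : CompactSpace ((cmDatum L 1 (Matrix.of fun i j : Fin 1 => if i.val + j.val + 1 = 1 then (1 : L) else 0)).Local v) := compactSpace_cmDatum_local_one_of_smul_eq L v w hw
  -- (R2) on `U(Φ₂)_v` for `ν₂ := (pr₁)_* ν_H` and a canonical family `m₂`
  obtain ⟨hν₂H, hν₂R⟩ := isHaarMeasure_map_fst_of_compactSpace L v νH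
  haveI := hν₂H
  haveI := hν₂R
  obtain ⟨ht₂, m₂, hm₂⟩ := exists_isCanonical_cmDatum_local_two L v (Measure.map (Prod.fst : (((cmDatum L 2 (Matrix.of fun i j : Fin 2 => if i.val + j.val + 1 = 2 then (1 : L) else 0)).Local v) ×
      ((cmDatum L 1 (Matrix.of fun i j : Fin 1 => if i.val + j.val + 1 = 1 then (1 : L) else 0)).Local v)) → ((cmDatum L 2 (Matrix.of fun i j : Fin 2 => if i.val + j.val + 1 = 2 then (1 : L) else 0)).Local v)) νH)
  obtain ⟨f, hf, hf1, hf0⟩ := hR2 L v hv (Measure.map (Prod.fst : (((cmDatum L 2 (Matrix.of fun i j : Fin 2 => if i.val + j.val + 1 = 2 then (1 : L) else 0)).Local v) ×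
      ((cmDatum L 1 (Matrix.of fun i j : Fin 1 => if i.val + j.val + 1 = 1 then (1 : L) else 0)).Local v)) → ((cmDatum L 2 (Matrix.of fun i j : Fin 2 => if i.val + j.val + 1 = 2 then (1 : L) else 0)).Local v)) νH) m₂ hm₂
  -- descent datum for `ψ`, read through the locally constant (C-an) function `Ψ`
  obtain ⟨ψε, hψε, hDψ⟩ := hD' ψ hψ
  obtain ⟨Ψ, hΨlc, -, hΨ⟩ := hm'.exists_isLocallyConstant_classOrbitalIntegral_eq ν' hψε
  have hB' : {m : C' | Ψ m = Ψ εC} ∈ 𝓝 εC := (hΨlc.isOpen_fiber (Ψ εC)).mem_nhds rfl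
  obtain ⟨VD, hVD, hdesc⟩ := hDψ _ hB'
  obtain ⟨Δ₁, VΔ, hVΔ, hΔ⟩ := hΔ'
  obtain ⟨Vc, hVc, hcount⟩ := hcnt
  -- the transfer near `ε_H`
  refine ⟨VD ∩ VΔ ∩ Vc, inter_mem (inter_mem hVD hVΔ) hVc, fun h => (Δ₁ * Ψ εC) * f h.1, ?_, ?_⟩
  · -- smoothness of `ψ′ = C₀ · (f ∘ pr₁)`
    refine (isLocSmooth_iff _).2 ⟨?_, ?_⟩
    · exact (hf.isLocallyConstant.comp_continuous continuous_fst).comp fun z => (Δ₁ * Ψ εC) * z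
    · have hsub : Function.support (fun h : (((cmDatum L 2 (Matrix.of fun i j : Fin 2 => if i.val + j.val + 1 = 2 then (1 : L) else 0)).Local v) ×
      ((cmDatum L 1 (Matrix.of fun i j : Fin 1 => if i.val + j.val + 1 = 1 then (1 : L) else 0)).Local v)) => (Δ₁ * Ψ εC) * f h.1) ⊆ (tsupport f) ×ˢ (Set.univ : Set ((cmDatum L 1 (Matrix.of fun i j : Fin 1 => if i.val + j.val + 1 = 1 then (1 : L) else 0)).Local v)) := by
        intro h hh
        refine ⟨subset_tsupport _ (Function.mem_support.2 fun h0 => hh ?_), Set.mem_univ _⟩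
        show Δ₁ * Ψ εC * f h.1 = 0
        rw [h0, mul_zero]
      exact HasCompactSupport.of_support_subset_isCompact (hf.hasCompactSupport.isCompact.prod isCompact_univ) hsub
  rintro γH ⟨⟨hγD, hγΔ⟩, hγc⟩ hγreg
  obtain ⟨hTfin, hDfin, hcomp, hnon⟩ := hcount γH hγc hγreg
  -- the `Q′`-side: only matched classes contribute, each with the value `Δ₁ · Ψ εC`
  set S : Set (ConjClasses ((cmDatum L 3 H').Local v)) := {c | ∃ x : ((cmDatum L 3 H').Local v), Q' γH (x * Quotient.out c * x⁻¹)} with hS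
  set T : Set (ConjClasses ((cmDatum L 3 H').Local v)) := {c | (∃ x : ((cmDatum L 3 H').Local v), Q' γH (x * Quotient.out c * x⁻¹)) ∧ IsLocalNormPair L H' v γH (Quotient.out c)} with hT
  set F : ConjClasses ((cmDatum L 3 H').Local v) → ℂ := fun c => ((finExplicitCollection L H' μ hl hr) v).Δ γH (Quotient.out c) * classOrbitalIntegral mG ψ c with hF
  have hST : S ∩ Function.support F = T ∩ Function.support F := by
    ext c
    simp only [Set.mem_inter_iff, hS, hT, Set.mem_setOf_eq, Function.mem_support]
    constructor
    · rintro ⟨hx, hne⟩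
      refine ⟨⟨hx, ?_⟩, hne⟩
      by_contra hnm
      apply hne
      rw [hF]
      simp only
      rw [finExplicitCollection_Δ L H' μ hl hr v, finExplicitDelta_of_not_isLocalNormPair L v H' γH μ hnm, zero_mul]
    · rintro ⟨⟨hx, -⟩, hne⟩
      exact ⟨hx, hne⟩
  have hLHS : (∑ᶠ c ∈ S, F c) = (T.ncard : ℂ) * (Δ₁ * Ψ εC) := by
    rw [← finsum_mem_inter_support F S, hST, finsum_mem_inter_support F T, finsum_mem_eq_finite_toFinset_sum _ hTfin,
      Finset.sum_congr rfl (g := fun _ => Δ₁ * Ψ εC), Finset.sum_const, nsmul_eq_mul, Set.ncard_eq_toFinset_card _ hTfin]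
    intro c hc
    obtain ⟨hx, hm⟩ := (hTfin.mem_toFinset.1 hc)
    obtain ⟨m, hmB, hPm, hval⟩ := hdesc γH hγD hγreg c hx hm
    rw [hF]
    simp only
    rw [hΔ γH hγΔ hγreg c hx hm, hval, hΨ m hPm, hmB]
  -- the `H`-side: the stable orbital integral of `ψ′`
  have hRHS : stableOrbitalIntegralRel (IsLocalStablyConjH L v) mH (fun h : (((cmDatum L 2 (Matrix.of fun i j : Fin 2 => if i.val + j.val + 1 = 2 then (1 : L) else 0)).Local v) ×
      ((cmDatum L 1 (Matrix.of fun i j : Fin 1 => if i.val + j.val + 1 = 1 then (1 : L) else 0)).Local v)) => (Δ₁ * Ψ εC) * f h.1) γH =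
      ∑ᶠ d ∈ {d : ConjClasses (((cmDatum L 2 (Matrix.of fun i j : Fin 2 => if i.val + j.val + 1 = 2 then (1 : L) else 0)).Local v) ×
      ((cmDatum L 1 (Matrix.of fun i j : Fin 1 => if i.val + j.val + 1 = 1 then (1 : L) else 0)).Local v)) | IsLocalStablyConjH L v γH (Quotient.out d)}, (Δ₁ * Ψ εC) * classOrbitalIntegral mH (fun h : (((cmDatum L 2 (Matrix.of fun i j : Fin 2 => if i.val + j.val + 1 = 2 then (1 : L) else 0)).Local v) ×
      ((cmDatum L 1 (Matrix.of fun i j : Fin 1 => if i.val + j.val + 1 = 1 then (1 : L) else 0)).Local v)) => f h.1) d := by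
    rw [stableOrbitalIntegralRel_def]
    refine finsum_mem_congr rfl fun d _ => ?_
    have hfun : (fun h : (((cmDatum L 2 (Matrix.of fun i j : Fin 2 => if i.val + j.val + 1 = 2 then (1 : L) else 0)).Local v) ×
      ((cmDatum L 1 (Matrix.of fun i j : Fin 1 => if i.val + j.val + 1 = 1 then (1 : L) else 0)).Local v)) => (Δ₁ * Ψ εC) * f h.1) = (Δ₁ * Ψ εC) • fun h : (((cmDatum L 2 (Matrix.of fun i j : Fin 2 => if i.val + j.val + 1 = 2 then (1 : L) else 0)).Local v) ×
      ((cmDatum L 1 (Matrix.of fun i j : Fin 1 => if i.val + j.val + 1 = 1 then (1 : L) else 0)).Local v)) => f h.1 := by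
      funext h; rfl
    rw [hfun, classOrbitalIntegral_eq, classOrbitalIntegral_eq, orbitalIntegral_smul, smul_eq_mul]
  -- regularity and the pinned-class facts at every class of the stable class
  have hP₁ : ∀ g x : ((cmDatum L 2 (Matrix.of fun i j : Fin 2 => if i.val + j.val + 1 = 2 then (1 : L) else 0)).Local v), IsRegularElt (g.val : GL (Fin 2) (LocalRing L v)) → IsRegularElt ((x * g * x⁻¹ : ((cmDatum L 2 (Matrix.of fun i j : Fin 2 => if i.val + j.val + 1 = 2 then (1 : L) else 0)).Local v)).val : GL (Fin 2) (LocalRing L v)) :=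
    fun g x hg => isRegularElt_fst_conj L v x g hg
  have hclass : ∀ d : ConjClasses (((cmDatum L 2 (Matrix.of fun i j : Fin 2 => if i.val + j.val + 1 = 2 then (1 : L) else 0)).Local v) ×
      ((cmDatum L 1 (Matrix.of fun i j : Fin 1 => if i.val + j.val + 1 = 1 then (1 : L) else 0)).Local v)), IsLocalStablyConjH L v γH (Quotient.out d) →
      IsLocalGRegular L v (Quotient.out (ConjClasses.mk ((Quotient.out d).1, (Quotient.out d).2))) ∧
      IsRegularElt ((Quotient.out (ConjClasses.mk (Quotient.out d).1)).val : GL (Fin 2) (LocalRing L v)) ∧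
      ConjClasses.mk ((Quotient.out d).1, (Quotient.out d).2) = d := by
    intro d hd
    have hdreg : IsLocalGRegular L v (Quotient.out d) := isLocalGRegular_of_isLocalStablyConjH L v hd hγreg
    refine ⟨isLocalGRegular_out_mk hdreg, ?_, Quotient.out_eq d⟩
    obtain ⟨x, hx⟩ := isConj_iff.1 (ConjClasses.mk_eq_mk_iff_isConj.1 (Quotient.out_eq (ConjClasses.mk (Quotient.out d).1)).symm)
    rw [← hx]
    exact isRegularElt_fst_conj L v x _ (isRegularElt_fst_snd_of_isLocalGRegular L v _ hdreg).1
  rw [hLHS, hRHS]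
  by_cases hZ : CompactSpace (Subgroup.centralizer ({γH.1} : Set ((cmDatum L 2 (Matrix.of fun i j : Fin 2 => if i.val + j.val + 1 = 2 then (1 : L) else 0)).Local v)))
  · -- ELLIPTIC: every class of the stable class contributes `Δ₁ Ψ(ε_C) · 1`
    rw [hcomp hZ, finsum_mem_eq_finite_toFinset_sum _ hDfin, Finset.sum_congr rfl (g := fun _ => Δ₁ * Ψ εC), Finset.sum_const, nsmul_eq_mul,
      Set.ncard_eq_toFinset_card _ hDfin]
    intro d hd
    have hst := hDfin.mem_toFinset.1 hd
    obtain ⟨hreg', hreg₁, hmk⟩ := hclass d hst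
    haveI : CompactSpace (Subgroup.centralizer ({(Quotient.out d).1} : Set ((cmDatum L 2 (Matrix.of fun i j : Fin 2 => if i.val + j.val + 1 = 2 then (1 : L) else 0)).Local v))) :=
      (compactSpace_centralizer_fst_iff_of_isLocalStablyConjH L v hγreg hst).1 hZ
    have h1 := hmH.classOrbitalIntegral_comp_fst_eq_of_compactSpace_of_map_fst νH (Measure.map (Prod.fst : (((cmDatum L 2 (Matrix.of fun i j : Fin 2 => if i.val + j.val + 1 = 2 then (1 : L) else 0)).Local v) ×
      ((cmDatum L 1 (Matrix.of fun i j : Fin 1 => if i.val + j.val + 1 = 1 then (1 : L) else 0)).Local v)) → ((cmDatum L 2 (Matrix.of fun i j : Fin 2 => if i.val + j.val + 1 = 2 then (1 : L) else 0)).Local v)) νH) rfl hm₂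
      (Quotient.out d).1 (Quotient.out d).2 hreg' hreg₁ hf.continuous
    rw [hmk] at h1
    rw [h1, hf1 _ (isRegularElt_fst_snd_of_isLocalGRegular L v _ (isLocalGRegular_of_isLocalStablyConjH L v hst hγreg)).1 inferInstance, mul_one]
  · -- NON-ELLIPTIC: the `Q′`-side is empty and every `H`-side term vanishes
    have hT0 : T = ∅ := by
      refine Set.eq_empty_iff_forall_notMem.2 fun c hc => ?_
      exact hnon hZ c hc.1 hc.2
    rw [hT0, Set.ncard_empty, Nat.cast_zero, zero_mul]
    symm
    refine finsum_mem_of_eqOn_zero fun d hd => ?_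
    obtain ⟨hreg', hreg₁, hmk⟩ := hclass d hd
    have hZ' : ¬ CompactSpace (Subgroup.centralizer ({(Quotient.out d).1} : Set ((cmDatum L 2 (Matrix.of fun i j : Fin 2 => if i.val + j.val + 1 = 2 then (1 : L) else 0)).Local v))) :=
      fun h => hZ ((compactSpace_centralizer_fst_iff_of_isLocalStablyConjH L v hγreg hd).2 h)
    obtain ⟨c₀, -, hc₀⟩ := hmH.exists_classOrbitalIntegral_comp_fst_eq_smul_of_haar νH (Measure.map (Prod.fst : (((cmDatum L 2 (Matrix.of fun i j : Fin 2 => if i.val + j.val + 1 = 2 then (1 : L) else 0)).Local v) ×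
      ((cmDatum L 1 (Matrix.of fun i j : Fin 1 => if i.val + j.val + 1 = 1 then (1 : L) else 0)).Local v)) → ((cmDatum L 2 (Matrix.of fun i j : Fin 2 => if i.val + j.val + 1 = 2 then (1 : L) else 0)).Local v)) νH) hP₁ hm₂ ht₂
      (Quotient.out d).1 (Quotient.out d).2 hreg' (isRegularElt_fst_snd_of_isLocalGRegular L v _ (isLocalGRegular_of_isLocalStablyConjH L v hd hγreg)).1
    have h1 := hc₀ f
    rw [hmk] at h1
    show Δ₁ * Ψ εC * classOrbitalIntegral mH (fun h => f h.1) d = 0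
    rw [h1, hf0 _ (isRegularElt_fst_snd_of_isLocalGRegular L v _ (isLocalGRegular_of_isLocalStablyConjH L v hd hγreg)).1 hZ', mul_zero, mul_zero]

end CompactSide

end Literature.NumberTheory.Rogawski1990

end
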